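import Summits.QuantumFields.YangMills.Theorems.BalabanUVNodesN18UniformDecayAlongRunWindows
import Summits.QuantumFields.YangMills.Theorems.BalabanUVNodesN18RunWindowEdgeRecord

/-!
# BalabanUVNodes ∕ N18 — THE (5.10) TELESCOPE ALONG THE RUN WINDOWS OF (0.20), RECORD EDITION: at W1-19's kernels of record `objectsOfRecord₁₃ F N θ ℓ`, the
# RUN-WINDOW KERNEL LETTER OF RECORD (dag-n18-w1 FILE 4's spelling) + the level-0 row of record ⟹ the k-UNIFORM (5.10) class OF RECORD at every window of every
# in-window run (Track A, DAG node N18 = NE5; key K3⁸ `SpineGivenEndpointR13SepCoPHV` = stmt-QuantumFields-27366, skeleton v6 b4e55110ab73e679; width seat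
# `pub-ymgap-dag-n18-w4` g8, FILE 11 — record edition of FILE 10 `…N18UniformDecayAlongRunWindows`; `--kind proof --supports stmt-QuantumFields-27366 --as helper`, COUNT-NEUTRAL)

HONEST FRAMING.  Count-neutral kernel bookkeeping BY NAME: FILE 10 §1 instantiated at the merged term family of record
`mergedTermFamilyMatT F N (TβOfRecord₁₃ F N) (chiβOfRecord₁₃ F N θ) θ.εbg` in the record's β-chart (`θ.ρ8`, `θ.bV`; instances bound by `letI` exactly as in W1-19's
`objectsOfRecord₁₃` ∕ FILE 5 §5), i.e. at the kernels `(objectsOfRecord₁₃ F N θ ℓ).EA 0 g · (pt k μ ν z) = Π_{k+1}(g; μν z)` (W1-19 `objectsOfRecord₁₃_EA_pt`, `rfl`).  The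
RUN-WINDOW KERNEL LETTER OF RECORD (N18's η-rate asked ONLY along the in-window (0.20)-runs of a β; dag-n18-w1 FILE 4 `…N18RunWindowEdgeRecord` p632519's hypothesis spelling,
VERBATIM), the LEVEL-0 (5.10) row of record (FILE 5 §5's `kernelDecayOfRecord₁₃_of_kernelStepRateOfRecord₁₃_of_base` spelling, verbatim) and the runs' window-stability
`Step.InInterval` are DISPLAYED HYPOTHESES; nothing of Bałaban's is asserted, inhabited, discharged or refuted; NE5 NOT PRINTED for d = 4; N18 ∕ (D4) NOT discharged; NOT a
proof of `stub_rates13HV` ∕ `stub_expansion13HV`; K3⁸ OPEN (v6), not claimed, NO skeleton re-keyed (R-N18-RUN remains a located input); K3⁷ 20544 aside; counts UNMOVED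
(typed 28∕28 · discharged 5∕27 (A 5∕28)).  One finite four-torus programme at fixed `ε`, Bałaban AS PRINTED; R4 closes the conditional finite-𝕋⁴ rung `BalabanLadder.UV`
only — NOT ℝ⁴, NOT infinite volume, NOT OS, NOT a mass gap, NOT Clay; no summit statement is proved by this seat.  THEOREMS ONLY: 0 `def`, 0 `instance`, 0 `sorry`.

WHY.  The v5∕v6 bills read the (5.10)∕(UD) row of record BOX-keyed — dag-n27-w1's `hdec := KernelDecayOfRecord₁₃ F N θ 0 1 ℓ.κ` (`KernelDecay … (Window θ.γ)`), which FILE 5 §5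
derives from the BOX letter of record `KernelStepRateOfRecord₁₃` + the level-0 row.  Under the located repair R-N18-RUN (dag-n18-w1 FILE 1–4: key N18 on the in-window
(0.20)-runs; the box letter is presumptively dead mod H_FE′) that derivation has no input, and FILE 10's module docstring records why the BOX row is not telescope-derivable
from run data at all (a positive β-floor gives every first entry a FINITE in-window forward life).  What the telescope DOES deliver from the run-window letter of record
is the k-uniform class OF RECORD AT THE RUN WINDOWS — this file — the row a run-keyed bill would read in place of `hdec`, at the tuned runs it actually evaluates.

WHAT (theorems only).  ★★ `decay510_runWindow_objectsOfRecord₁₃_of_runWindowStepRate_of_base` (free letters `κ θ₅ C₅`: run-window kernel letter of record + level-0 row of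
record ⟹ `Decay510 (z ↦ (objectsOfRecord₁₃ F N θ ℓ).EA 0 (g_j, g_{j+1}, …) · (pt k μ ν z)) (E₀ + C₅θ₅∕(1−θ₅)) κ` at every window `j + k ≤ n` of every in-window run of
ANY `β`) · ★ `decay510_runWindow_objectsOfRecord₁₃_of_letters_of_base` (the same keyed on the letter block `ℓ` under `ℓ.Signs`, rate `ℓ.κ`) ·
`decay510_runWindow_objectsOfRecord₁₃_of_kernelStepRateOfRecord₁₃_of_base` (today's BOX letter of record gives the same — dag-n18-w1 FILE 4's
`runWindowKernelStepRateOfRecord₁₃_of_kernelStepRateOfRecord₁₃` BY NAME; the run-window row is WEAKER than FILE 5 §5's input) ·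
`decay510_runWindow_objectsOfRecord₁₃_of_n18At_pin_of_base` (under K3's reading pin `(𝔯.lit …).u3 = objectsOfRecord₁₃ …`: the CURRENT box conjunct `N18At` at the pinned
bundle of record + the level-0 row ⟹ the run-window class of record — FILE 4's `runWindowKernelStepRate_of_n18At_pin` BY NAME).

References (TYPES ∕ locators only): [Balaban1987RG1] CMP **109** (1987): (0.18)–(0.20) pp. 255–256 (the runs), Thm 1 p. 259 (NE5 NOT printed), (1.6) p. 261, (1.18) p. 263,
(1.20)–(1.22) p. 264, (5.10) p. 293.
-/

noncomputable section

open scoped BigOperators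

namespace YMDAG.N18.UniformDecayAlongRunWindows

open Literature.MathematicalPhysics.QuantumFieldTheory.Balaban1983to89
open Literature.MathematicalPhysics.QuantumFieldTheory.Balaban1983to89.T4Continuum (T4Family ULoop)
open Literature.MathematicalPhysics.QuantumFieldTheory.Balaban1983to89.T4OutputRate (Window)
open Literature.MathematicalPhysics.QuantumFieldTheory.Balaban1983to89.FlowStep (HBeta RGEqH)
open Literature.MathematicalPhysics.QuantumFieldTheory.Balaban1983to89.B12Sec2to5 (l1 Decay510)
open Node00 (Stage13Params Stage13HParams U3Letters₁₁ mergedTermFamilyMatT TβOfRecord₁₃ chiβOfRecord₁₃)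
open Node00.U3OfKernels (kernelA pt objectsOfRecord₁₃)
open Node00.U3KernelLetters (KernelStepRateOfRecord₁₃)
open YMDAG.N18.RunWindowEdge (runWindowKernelStepRateOfRecord₁₃_of_kernelStepRateOfRecord₁₃ runWindowKernelStepRate_of_n18At_pin)
open YMDAG.UVSplit

section Record

open scoped Matrix.Norms.L2Operator

variable (F : T4Family) (N : ℕ) [NeZero N]

/-- ★★ **THE k-UNIFORM (5.10) CLASS OF RECORD AT EVERY RUN WINDOW** (free letters): the RUN-WINDOW KERNEL LETTER OF RECORD along the in-window (0.20)-runs of a β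
(`|Π_{k+1}(g_{j+1}, …; z) − Π_{k+2}(g_j, g_{j+1}, …; z)| ≤ C₅θ₅^{k+1}e^{−κ|z|₁}` at the kernels of record, dag-n18-w1 FILE 4's spelling) + the LEVEL-0 (5.10) row of record
with constant `E₀`, `0 ≤ C₅`, `0 ≤ θ₅ < 1` ⟹ at every window `j + k ≤ n` of every such run the level-`k` kernel of record is in the class
`Decay510 · (E₀ + C₅·θ₅∕(1−θ₅)) κ` — ONE constant for all levels, NO box-keyed N18 letter (FILE 10 `decay510_runWindow_of_runWindowStepRate_of_base` at the merged term
family of record; faces `rfl`). [cite: Balaban1987RG1, (0.18)–(0.20) pp.255–256, Thm 1 p.259, (1.6) p.261 and (5.10) p.293 (mechanism; nothing of the record asserted)] -/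
theorem decay510_runWindow_objectsOfRecord₁₃_of_runWindowStepRate_of_base (θ : Stage13Params F N) (ℓ : U3Letters₁₁) {β : HBeta} {κ θ₅ C₅ E₀ : ℝ}
    (hθ0 : 0 ≤ θ₅) (hθ1 : θ₅ < 1) (hC₅ : 0 ≤ C₅)
    (h18run : ∀ (n : ℕ) (gs : ℕ → ℝ), RGEqH n β gs → Step.InInterval θ.γ n gs → ∀ j k : ℕ, j + (k + 1) ≤ n → ∀ (μ ν : Fin 4) (z : Fin 4 → ℤ),
      |(objectsOfRecord₁₃ F N θ ℓ).EA 0 (fun i => gs (j + 1 + i)) PUnit.unit (pt k μ ν z) -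
          (objectsOfRecord₁₃ F N θ ℓ).EA 0 (fun i => gs (j + i)) PUnit.unit (pt (k + 1) μ ν z)| ≤ C₅ * θ₅ ^ (k + 1) * Real.exp (-(κ * l1 z)))
    (h0 : letI := θ.instVβ₁; letI := θ.instVβ₂; letI := θ.instιβ
      ∀ g ∈ Window θ.γ, ∀ (μ ν : Fin 4),
        Decay510 (kernelA F (mergedTermFamilyMatT F N (TβOfRecord₁₃ F N) (chiβOfRecord₁₃ F N θ) θ.εbg) θ.ρ8 θ.bV g 0 μ ν) E₀ κ)
    {n : ℕ} {gs : ℕ → ℝ} (hR : RGEqH n β gs) (hI : Step.InInterval θ.γ n gs) {j k : ℕ} (hjk : j + k ≤ n) (μ ν : Fin 4) :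
    Decay510 (fun z => (objectsOfRecord₁₃ F N θ ℓ).EA 0 (fun i => gs (j + i)) PUnit.unit (pt k μ ν z)) (E₀ + C₅ * (θ₅ / (1 - θ₅))) κ := by
  letI := θ.instVβ₁; letI := θ.instVβ₂; letI := θ.instιβ
  have h18' : ∀ (n : ℕ) (gs : ℕ → ℝ), RGEqH n β gs → Step.InInterval θ.γ n gs → ∀ j k : ℕ, j + (k + 1) ≤ n → ∀ (μ ν : Fin 4) (z : Fin 4 → ℤ),
      |kernelA F (mergedTermFamilyMatT F N (TβOfRecord₁₃ F N) (chiβOfRecord₁₃ F N θ) θ.εbg) θ.ρ8 θ.bV (fun i => gs (j + 1 + i)) k μ ν z -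
          kernelA F (mergedTermFamilyMatT F N (TβOfRecord₁₃ F N) (chiβOfRecord₁₃ F N θ) θ.εbg) θ.ρ8 θ.bV (fun i => gs (j + i)) (k + 1) μ ν z| ≤
        C₅ * θ₅ ^ (k + 1) * Real.exp (-(κ * l1 z)) :=
    fun n gs hR hI j k hjk μ ν z => h18run n gs hR hI j k hjk μ ν z
  exact decay510_runWindow_of_runWindowStepRate_of_base F θ.ρ8 θ.bV hθ0 hθ1 hC₅ h18' h0 hR hI hjk μ ν

/-- ★ **THE SAME KEYED ON A LETTER BLOCK `ℓ` UNDER ITS SIGNS** (the bills' shapes: the run-window letter at `(ℓ.κ, ℓ.θ₅, ℓ.C₅)`, class at rate `ℓ.κ`; `0 ≤ ℓ.C₅` and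
`0 < ℓ.θ₅ < 1` are `ℓ.Signs`). [cite: Balaban1987RG1, Thm 1 p.259, (1.6) p.261 and (5.10) p.293 (mechanism; nothing of the record asserted)] -/
theorem decay510_runWindow_objectsOfRecord₁₃_of_letters_of_base (θ : Stage13Params F N) (ℓ : U3Letters₁₁) (hs : ℓ.Signs) {β : HBeta} {E₀ : ℝ}
    (h18run : ∀ (n : ℕ) (gs : ℕ → ℝ), RGEqH n β gs → Step.InInterval θ.γ n gs → ∀ j k : ℕ, j + (k + 1) ≤ n → ∀ (μ ν : Fin 4) (z : Fin 4 → ℤ),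
      |(objectsOfRecord₁₃ F N θ ℓ).EA 0 (fun i => gs (j + 1 + i)) PUnit.unit (pt k μ ν z) -
          (objectsOfRecord₁₃ F N θ ℓ).EA 0 (fun i => gs (j + i)) PUnit.unit (pt (k + 1) μ ν z)| ≤ ℓ.C₅ * ℓ.θ₅ ^ (k + 1) * Real.exp (-(ℓ.κ * l1 z)))
    (h0 : letI := θ.instVβ₁; letI := θ.instVβ₂; letI := θ.instιβ
      ∀ g ∈ Window θ.γ, ∀ (μ ν : Fin 4),
        Decay510 (kernelA F (mergedTermFamilyMatT F N (TβOfRecord₁₃ F N) (chiβOfRecord₁₃ F N θ) θ.εbg) θ.ρ8 θ.bV g 0 μ ν) E₀ ℓ.κ)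
    {n : ℕ} {gs : ℕ → ℝ} (hR : RGEqH n β gs) (hI : Step.InInterval θ.γ n gs) {j k : ℕ} (hjk : j + k ≤ n) (μ ν : Fin 4) :
    Decay510 (fun z => (objectsOfRecord₁₃ F N θ ℓ).EA 0 (fun i => gs (j + i)) PUnit.unit (pt k μ ν z)) (E₀ + ℓ.C₅ * (ℓ.θ₅ / (1 - ℓ.θ₅))) ℓ.κ :=
  decay510_runWindow_objectsOfRecord₁₃_of_runWindowStepRate_of_base F N θ ℓ hs.θ₅_pos.le hs.θ₅_lt_one hs.C₅_nonneg h18run h0 hR hI hjk μ ν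

/-- **TODAY's BOX LETTER OF RECORD GIVES THE SAME** (sanity; the run-window row is WEAKER than FILE 5 §5's input): `KernelStepRateOfRecord₁₃ F N θ ℓ.κ ℓ.θ₅ ℓ.C₅` ⟹ the
run-window kernel letter of record along the in-window runs of ANY β (dag-n18-w1 FILE 4's `runWindowKernelStepRateOfRecord₁₃_of_kernelStepRateOfRecord₁₃`, BY NAME), hence
the class at every run window. [cite: Balaban1987RG1, Thm 1 p.259 and (5.10) p.293 (mechanism; nothing of the record asserted)] -/
theorem decay510_runWindow_objectsOfRecord₁₃_of_kernelStepRateOfRecord₁₃_of_base (θ : Stage13Params F N) (ℓ : U3Letters₁₁) (hs : ℓ.Signs) {β : HBeta} {E₀ : ℝ}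
    (h18 : KernelStepRateOfRecord₁₃ F N θ ℓ.κ ℓ.θ₅ ℓ.C₅)
    (h0 : letI := θ.instVβ₁; letI := θ.instVβ₂; letI := θ.instιβ
      ∀ g ∈ Window θ.γ, ∀ (μ ν : Fin 4),
        Decay510 (kernelA F (mergedTermFamilyMatT F N (TβOfRecord₁₃ F N) (chiβOfRecord₁₃ F N θ) θ.εbg) θ.ρ8 θ.bV g 0 μ ν) E₀ ℓ.κ)
    {n : ℕ} {gs : ℕ → ℝ} (hR : RGEqH n β gs) (hI : Step.InInterval θ.γ n gs) {j k : ℕ} (hjk : j + k ≤ n) (μ ν : Fin 4) :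
    Decay510 (fun z => (objectsOfRecord₁₃ F N θ ℓ).EA 0 (fun i => gs (j + i)) PUnit.unit (pt k μ ν z)) (E₀ + ℓ.C₅ * (ℓ.θ₅ / (1 - ℓ.θ₅))) ℓ.κ :=
  decay510_runWindow_objectsOfRecord₁₃_of_letters_of_base F N θ ℓ hs
    (runWindowKernelStepRateOfRecord₁₃_of_kernelStepRateOfRecord₁₃ F N θ ℓ β h18) h0 hR hI hjk μ ν

end Record

/-! ## Under K3's reading pin `(𝔯.lit F θ hP g₀ os).u3 = objectsOfRecord₁₃ F N θ ℓ`: today's box conjunct `N18At` at the pinned bundle of record -/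

section Pin

open scoped Matrix.Norms.L2Operator

variable (F : T4Family) {N : ℕ} [NeZero N]

/-- **UNDER THE PIN, K3's CURRENT N18 CONJUNCT + THE LEVEL-0 ROW ⟹ THE RUN-WINDOW CLASS OF RECORD**: with `hpin` (K3's `U3PinnedKernels 𝔯 ℓ'` at one tuple, `ℓ := ℓ' F θ`)
the box conjunct `N18At (rateCarriersOfRecord₁₃CoPH 𝔯 F θ hP g₀ os kk).u3` — the N18 face of `PHolderD4`'s rates predicate at the bundle of record — gives the run-window kernel
letter of record (dag-n18-w1 FILE 4 `runWindowKernelStepRate_of_n18At_pin`, BY NAME), hence, with the level-0 row of record under `ℓ.Signs`, the k-uniform (5.10) class of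
record at every window of every in-window run of ANY β.  So a run re-keying of the N18 conjunct per R-N18-RUN keeps this row available WITHOUT the box.
[cite: Balaban1987RG1, Thm 1 p.259, (1.6) p.261 and (5.10) p.293 (mechanism; nothing of the record asserted)] -/
theorem decay510_runWindow_objectsOfRecord₁₃_of_n18At_pin_of_base (𝔯 : RateReading₁₃CoPH N) (θ : Stage13HParams F N) (hP : θ.Provisos₁₃CoPH F N)
    (g₀ : ℕ → ℝ) (os : List (ULoop F)) (ℓ : U3Letters₁₁) (hs : ℓ.Signs) (hpin : (𝔯.lit F θ hP g₀ os).u3 = objectsOfRecord₁₃ F N θ.toStage13Params ℓ)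
    (kk : ℕ) {β : HBeta} {E₀ : ℝ} (h18 : N18At (rateCarriersOfRecord₁₃CoPH 𝔯 F θ hP g₀ os kk).u3)
    (h0 : letI := θ.instVβ₁; letI := θ.instVβ₂; letI := θ.instιβ
      ∀ g ∈ Window θ.γ, ∀ (μ ν : Fin 4),
        Decay510 (kernelA F (mergedTermFamilyMatT F N (TβOfRecord₁₃ F N) (chiβOfRecord₁₃ F N θ.toStage13Params) θ.εbg) θ.ρ8 θ.bV g 0 μ ν) E₀ ℓ.κ)
    {n : ℕ} {gs : ℕ → ℝ} (hR : RGEqH n β gs) (hI : Step.InInterval θ.γ n gs) {j k : ℕ} (hjk : j + k ≤ n) (μ ν : Fin 4) :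
    Decay510 (fun z => (objectsOfRecord₁₃ F N θ.toStage13Params ℓ).EA 0 (fun i => gs (j + i)) PUnit.unit (pt k μ ν z))
      (E₀ + ℓ.C₅ * (ℓ.θ₅ / (1 - ℓ.θ₅))) ℓ.κ :=
  decay510_runWindow_objectsOfRecord₁₃_of_letters_of_base F N θ.toStage13Params ℓ hs
    (runWindowKernelStepRate_of_n18At_pin F 𝔯 θ hP g₀ os ℓ hpin kk β h18) h0 hR hI hjk μ ν

end Pin

end YMDAG.N18.UniformDecayAlongRunWindows
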